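import Mathlib
import Summits.NavierStokesRegularity.NavierStokesRegularity.Theorems.EulerZoomLiouvillePowerGaugeEulerLiouvilleHoopSliceChart
import Summits.NavierStokesRegularity.NavierStokesRegularity.Theorems.EulerZoomLiouvillePowerGaugeEulerLiouvilleHoopSliceFrame

/-!
# R48 plate t51-SM: the SLICE MASS IDENTITY (nsreg-p2 ROUND-48 «EVERY LINE, EVERY BEND», `NsregP2.R48.SliceMassIdentity`,
text VERBATIM from `r48/Sketch48.lean` c9b3454dee49e2f5 l.77–81; seat ns-ezl-w2 g5, `--supports stmt-NavierStokesRegularity-19832 --as helper`)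

For `C¹` divergence-free `V`, every height `s` and radius `T₀ > 0`:
`T₀ · ⟨V_r⟩_θ(s, T₀) = − d/ds ∫₀^{T₀} t ⟨V_z⟩_θ(s, t) dt` (lateral flux through the circle = minus the `s`-derivative of the
axial flux through the disc).  Proof in the smooth slice chart of ns-sfl-p1 g8 (`…HoopSliceChart`: `a = ⟪V∘axisPt, R_θe₀⟫`,
`b = ⟪V∘axisPt, R_θe₁⟫`, `c = V_z∘axisPt`, all real `t`): `div V = 0` in the rotated frame gives `∂_t(t a) = −∂_θ b − t ∂_σ c`
pointwise; the `θ`-integral kills `∂_θ b` (periodicity); the `t`-integral over `[0, T₀]` gives `T₀∫_θ a(s, T₀, ·) = −∫₀^{T₀} t∫_θ ∂_σc`,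
and `∫₀^{T₀} t ∫_θ ∂_σ c = d/ds ∫₀^{T₀} t∫_θ c` by differentiation under both integral signs
(`hasDerivAt_intervalIntegral_of_continuous`).  On the circle `t = T₀ > 0`, `a = V_r` (`inner_rotZ_single_zero_eq_radialVelocity`).

HONEST FRAMING: class-free calculus (a statement of a ROUND-48 instrument); nothing about the crux E (19832 OPEN) or NS regularity.
[nsreg-p2 R48 §1.2; folklore (divergence theorem on a disc)]
-/

noncomputable section

open Set Filter Topology Metric Function MeasureTheory Real WithLp
open scoped Interval InnerProductSpace RealInnerProductSpace

set_option linter.dupNamespace false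

namespace Summit.NavierStokesRegularity.NavierStokesRegularity.Theorems.PowerGaugeEulerLiouville.HoopCore

open Literature.Analysis Literature.Analysis.FluidPDE

/-- **SLICE MASS IDENTITY** (`NsregP2.R48.SliceMassIdentity`, text verbatim): for `C¹` divergence-free `V`, `0 < T₀`,
`T₀ · circleAvg V_r (s, T₀) = − d/ds ∫₀^{T₀} t · circleAvg V_z (s, t) dt`. [nsreg-p2 R48 §1.2; folklore] -/
theorem sliceMassIdentity :
    ∀ (V : EuclideanSpace ℝ (Fin 3) → EuclideanSpace ℝ (Fin 3)), ContDiff ℝ 1 V →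
      (∀ y, VectorCalculus.divergence V y = 0) →
      ∀ (s T₀ : ℝ), 0 < T₀ →
        T₀ * circleAvg (radialVelocity V) s T₀
          = - deriv (fun σ => ∫ t in (0 : ℝ)..T₀, t * circleAvg (axialVelocity V) σ t) s := by
  intro V hV hdiv s T₀ hT₀
  have hVd : Differentiable ℝ V := hV.differentiable one_ne_zero
  have hVc : Continuous V := hV.continuous
  -- joint continuity of the chart functions `a, b, c` and of the frame entries `ad, mθ, cσ` on `ℝ × ℝ × ℝ`
  have hac := continuous_sliceA hVc
  have hcc := continuous_sliceC hVc
  have hadc : Continuous fun p : ℝ × ℝ × ℝ =>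
      ⟪fderiv ℝ V (axisPt p.1 p.2.1 p.2.2) (rotZ p.2.2 (EuclideanSpace.single (0 : Fin 3) (1 : ℝ))),
        rotZ p.2.2 (EuclideanSpace.single (0 : Fin 3) (1 : ℝ))⟫ :=
    continuous_sliceEntry hV continuous_rotZ_single_zero continuous_rotZ_single_zero
  have hmθc : Continuous fun p : ℝ × ℝ × ℝ =>
      ⟪fderiv ℝ V (axisPt p.1 p.2.1 p.2.2) (rotZ p.2.2 (EuclideanSpace.single (1 : Fin 3) (1 : ℝ))),
        rotZ p.2.2 (EuclideanSpace.single (1 : Fin 3) (1 : ℝ))⟫ :=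
    continuous_sliceEntry hV continuous_rotZ_single_one continuous_rotZ_single_one
  have hcσc : Continuous fun p : ℝ × ℝ × ℝ => ⟪fderiv ℝ V (axisPt p.1 p.2.1 p.2.2) eZ, eZ⟫ :=
    continuous_sliceEntry hV (u := fun _ => eZ) (w := fun _ => eZ) continuous_const continuous_const
  -- sections
  have sec1 : ∀ {F : ℝ × ℝ × ℝ → ℝ}, Continuous F → ∀ σ t, Continuous fun θ : ℝ => F (σ, t, θ) :=
    fun hF σ t => hF.comp (continuous_const.prodMk (continuous_const.prodMk continuous_id))
  -- ### (1) `d/dt ∫_θ a = ∫_θ ad` at height `s`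
  have hA : ∀ t, HasDerivAt
      (fun t => ∫ θ in (0 : ℝ)..2 * π, ⟪V (axisPt s t θ), rotZ θ (EuclideanSpace.single (0 : Fin 3) (1 : ℝ))⟫)
      (∫ θ in (0 : ℝ)..2 * π, ⟪fderiv ℝ V (axisPt s t θ) (rotZ θ (EuclideanSpace.single (0 : Fin 3) (1 : ℝ))),
        rotZ θ (EuclideanSpace.single (0 : Fin 3) (1 : ℝ))⟫) t :=
    fun t => hasDerivAt_intervalIntegral_of_continuous
      (F := fun t θ => ⟪V (axisPt s t θ), rotZ θ (EuclideanSpace.single (0 : Fin 3) (1 : ℝ))⟫)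
      (F' := fun t θ => ⟪fderiv ℝ V (axisPt s t θ) (rotZ θ (EuclideanSpace.single (0 : Fin 3) (1 : ℝ))),
        rotZ θ (EuclideanSpace.single (0 : Fin 3) (1 : ℝ))⟫)
      (fun t θ => hasDerivAt_sliceA_radius hVd s t θ) (continuous_uncurry_slice hac s)
      (continuous_uncurry_slice hadc s) 0 (2 * π) t
  -- ### (2) `∫_θ a + t ∫_θ ad = −t ∫_θ cσ` (divergence in the rotated frame, periodicity of `b`)
  have hkey : ∀ t, (∫ θ in (0 : ℝ)..2 * π, ⟪V (axisPt s t θ), rotZ θ (EuclideanSpace.single (0 : Fin 3) (1 : ℝ))⟫) +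
      t * (∫ θ in (0 : ℝ)..2 * π, ⟪fderiv ℝ V (axisPt s t θ) (rotZ θ (EuclideanSpace.single (0 : Fin 3) (1 : ℝ))),
        rotZ θ (EuclideanSpace.single (0 : Fin 3) (1 : ℝ))⟫) =
      -(t * ∫ θ in (0 : ℝ)..2 * π, ⟪fderiv ℝ V (axisPt s t θ) eZ, eZ⟫) := by
    intro t
    have hpt : ∀ θ, ⟪V (axisPt s t θ), rotZ θ (EuclideanSpace.single (0 : Fin 3) (1 : ℝ))⟫ +
        t * ⟪fderiv ℝ V (axisPt s t θ) (rotZ θ (EuclideanSpace.single (0 : Fin 3) (1 : ℝ))),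
          rotZ θ (EuclideanSpace.single (0 : Fin 3) (1 : ℝ))⟫ =
        -(t * ⟪fderiv ℝ V (axisPt s t θ) (rotZ θ (EuclideanSpace.single (1 : Fin 3) (1 : ℝ))),
            rotZ θ (EuclideanSpace.single (1 : Fin 3) (1 : ℝ))⟫ -
          ⟪V (axisPt s t θ), rotZ θ (EuclideanSpace.single (0 : Fin 3) (1 : ℝ))⟫) -
          t * ⟪fderiv ℝ V (axisPt s t θ) eZ, eZ⟫ := by
      intro θ
      have h := sliceChart_hdiv hdiv s t θ
      linarith
    have i1 : IntervalIntegrable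
        (fun θ => ⟪V (axisPt s t θ), rotZ θ (EuclideanSpace.single (0 : Fin 3) (1 : ℝ))⟫) volume 0 (2 * π) :=
      (sec1 hac s t).intervalIntegrable _ _
    have i2 : IntervalIntegrable (fun θ => t * ⟪fderiv ℝ V (axisPt s t θ)
        (rotZ θ (EuclideanSpace.single (0 : Fin 3) (1 : ℝ))), rotZ θ (EuclideanSpace.single (0 : Fin 3) (1 : ℝ))⟫)
        volume 0 (2 * π) :=
      (continuous_const.mul (sec1 hadc s t)).intervalIntegrable _ _
    have i3 : IntervalIntegrable (fun θ => -(t * ⟪fderiv ℝ V (axisPt s t θ)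
        (rotZ θ (EuclideanSpace.single (1 : Fin 3) (1 : ℝ))), rotZ θ (EuclideanSpace.single (1 : Fin 3) (1 : ℝ))⟫ -
          ⟪V (axisPt s t θ), rotZ θ (EuclideanSpace.single (0 : Fin 3) (1 : ℝ))⟫)) volume 0 (2 * π) :=
      ((continuous_const.mul (sec1 hmθc s t)).sub (sec1 hac s t)).neg.intervalIntegrable _ _
    have i4 : IntervalIntegrable (fun θ => t * ⟪fderiv ℝ V (axisPt s t θ) eZ, eZ⟫) volume 0 (2 * π) :=
      (continuous_const.mul (sec1 hcσc s t)).intervalIntegrable _ _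
    have hbθ : ∫ θ in (0 : ℝ)..2 * π, (t * ⟪fderiv ℝ V (axisPt s t θ)
        (rotZ θ (EuclideanSpace.single (1 : Fin 3) (1 : ℝ))), rotZ θ (EuclideanSpace.single (1 : Fin 3) (1 : ℝ))⟫ -
          ⟪V (axisPt s t θ), rotZ θ (EuclideanSpace.single (0 : Fin 3) (1 : ℝ))⟫) =
        ⟪V (axisPt s t (2 * π)), rotZ (2 * π) (EuclideanSpace.single (1 : Fin 3) (1 : ℝ))⟫ -
          ⟪V (axisPt s t 0), rotZ 0 (EuclideanSpace.single (1 : Fin 3) (1 : ℝ))⟫ :=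
      intervalIntegral.integral_eq_sub_of_hasDerivAt (fun θ _ => hasDerivAt_sliceB_angle hVd s t θ)
        (((continuous_const.mul (sec1 hmθc s t)).sub (sec1 hac s t)).intervalIntegrable _ _)
    have hper : ⟪V (axisPt s t (2 * π)), rotZ (2 * π) (EuclideanSpace.single (1 : Fin 3) (1 : ℝ))⟫ =
        ⟪V (axisPt s t 0), rotZ 0 (EuclideanSpace.single (1 : Fin 3) (1 : ℝ))⟫ := by
      rw [axisPt_two_pi, rotZ_two_pi_single_one]
    calc _ = ∫ θ in (0 : ℝ)..2 * π, (⟪V (axisPt s t θ), rotZ θ (EuclideanSpace.single (0 : Fin 3) (1 : ℝ))⟫ +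
          t * ⟪fderiv ℝ V (axisPt s t θ) (rotZ θ (EuclideanSpace.single (0 : Fin 3) (1 : ℝ))),
            rotZ θ (EuclideanSpace.single (0 : Fin 3) (1 : ℝ))⟫) := by
            rw [← intervalIntegral.integral_const_mul t, ← intervalIntegral.integral_add i1 i2]
      _ = ∫ θ in (0 : ℝ)..2 * π, (-(t * ⟪fderiv ℝ V (axisPt s t θ) (rotZ θ (EuclideanSpace.single (1 : Fin 3) (1 : ℝ))),
            rotZ θ (EuclideanSpace.single (1 : Fin 3) (1 : ℝ))⟫ -
          ⟪V (axisPt s t θ), rotZ θ (EuclideanSpace.single (0 : Fin 3) (1 : ℝ))⟫) -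
          t * ⟪fderiv ℝ V (axisPt s t θ) eZ, eZ⟫) := intervalIntegral.integral_congr fun θ _ => hpt θ
      _ = -(∫ θ in (0 : ℝ)..2 * π, (t * ⟪fderiv ℝ V (axisPt s t θ)
            (rotZ θ (EuclideanSpace.single (1 : Fin 3) (1 : ℝ))), rotZ θ (EuclideanSpace.single (1 : Fin 3) (1 : ℝ))⟫ -
          ⟪V (axisPt s t θ), rotZ θ (EuclideanSpace.single (0 : Fin 3) (1 : ℝ))⟫)) -
          t * ∫ θ in (0 : ℝ)..2 * π, ⟪fderiv ℝ V (axisPt s t θ) eZ, eZ⟫ := by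
            rw [intervalIntegral.integral_sub i3 i4, intervalIntegral.integral_neg, intervalIntegral.integral_const_mul t]
      _ = _ := by rw [hbθ, hper, sub_self, neg_zero, zero_sub]
  -- ### (3) `d/dt (t ∫_θ a) = −t ∫_θ cσ`, integrated over `[0, T₀]`
  have hgc : Continuous fun t => -(t * ∫ θ in (0 : ℝ)..2 * π, ⟪fderiv ℝ V (axisPt s t θ) eZ, eZ⟫) :=
    (continuous_id.mul (intervalIntegral.continuous_parametric_intervalIntegral_of_continuous'
      (continuous_uncurry_slice hcσc s) _ _)).neg
  have hG : ∀ t, HasDerivAt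
      (fun t : ℝ => t * ∫ θ in (0 : ℝ)..2 * π, ⟪V (axisPt s t θ), rotZ θ (EuclideanSpace.single (0 : Fin 3) (1 : ℝ))⟫)
      (-(t * ∫ θ in (0 : ℝ)..2 * π, ⟪fderiv ℝ V (axisPt s t θ) eZ, eZ⟫)) t := by
    intro t
    have h := (hasDerivAt_id' t).mul (hA t)
    refine h.congr_deriv ?_
    rw [one_mul]
    exact hkey t
  have hFTC := intervalIntegral.integral_eq_sub_of_hasDerivAt (a := 0) (b := T₀) (fun t _ => hG t)
    (hgc.intervalIntegrable _ _)
  rw [intervalIntegral.integral_neg, zero_mul, sub_zero] at hFTC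
  -- hFTC : -(∫ t in 0..T₀, t * ∫_θ cσ) = T₀ * ∫_θ a(s, T₀, ·)
  -- ### (4) `d/ds ∫₀^{T₀} t · circleAvg V_z (s, t) dt = ∫₀^{T₀} t · (2π)⁻¹ ∫_θ cσ dt`
  have hC : ∀ σ t, HasDerivAt (fun σ => ∫ θ in (0 : ℝ)..2 * π, axialVelocity V (axisPt σ t θ))
      (∫ θ in (0 : ℝ)..2 * π, ⟪fderiv ℝ V (axisPt σ t θ) eZ, eZ⟫) σ :=
    fun σ t => hasDerivAt_intervalIntegral_of_continuous (F := fun σ θ => axialVelocity V (axisPt σ t θ))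
      (F' := fun σ θ => ⟪fderiv ℝ V (axisPt σ t θ) eZ, eZ⟫)
      (fun σ θ => hasDerivAt_sliceC_height hVd σ t θ) (continuous_uncurry_radius hcc t)
      (continuous_uncurry_radius hcσc t) 0 (2 * π) σ
  have hIc : Continuous fun p : ℝ × ℝ => ∫ θ in (0 : ℝ)..2 * π, axialVelocity V (axisPt p.1 p.2 θ) :=
    continuous_parametric₂_intervalIntegral (F := fun σ t θ => axialVelocity V (axisPt σ t θ)) hcc _ _
  have hIσc : Continuous fun p : ℝ × ℝ => ∫ θ in (0 : ℝ)..2 * π, ⟪fderiv ℝ V (axisPt p.1 p.2 θ) eZ, eZ⟫ :=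
    continuous_parametric₂_intervalIntegral (F := fun σ t θ => ⟪fderiv ℝ V (axisPt σ t θ) eZ, eZ⟫) hcσc _ _
  have hH : HasDerivAt (fun σ => ∫ t in (0 : ℝ)..T₀,
      t * (1 / (2 * π) * ∫ θ in (0 : ℝ)..2 * π, axialVelocity V (axisPt σ t θ)))
      (∫ t in (0 : ℝ)..T₀, t * (1 / (2 * π) * ∫ θ in (0 : ℝ)..2 * π, ⟪fderiv ℝ V (axisPt s t θ) eZ, eZ⟫)) s :=
    hasDerivAt_intervalIntegral_of_continuous
      (F := fun σ t => t * (1 / (2 * π) * ∫ θ in (0 : ℝ)..2 * π, axialVelocity V (axisPt σ t θ)))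
      (F' := fun σ t => t * (1 / (2 * π) * ∫ θ in (0 : ℝ)..2 * π, ⟪fderiv ℝ V (axisPt σ t θ) eZ, eZ⟫))
      (fun σ t => ((hC σ t).const_mul (1 / (2 * π))).const_mul t)
      (continuous_snd.mul (continuous_const.mul hIc)) (continuous_snd.mul (continuous_const.mul hIσc)) 0 T₀ s
  -- ### (5) assemble
  simp only [circleAvg]
  rw [hH.deriv]
  have hrad : ∫ θ in (0 : ℝ)..2 * π, radialVelocity V (axisPt s T₀ θ) =
      ∫ θ in (0 : ℝ)..2 * π, ⟪V (axisPt s T₀ θ), rotZ θ (EuclideanSpace.single (0 : Fin 3) (1 : ℝ))⟫ :=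
    intervalIntegral.integral_congr fun θ _ => (inner_rotZ_single_zero_eq_radialVelocity V s hT₀ θ).symm
  have hpull : ∫ t in (0 : ℝ)..T₀, t * (1 / (2 * π) * ∫ θ in (0 : ℝ)..2 * π, ⟪fderiv ℝ V (axisPt s t θ) eZ, eZ⟫) =
      1 / (2 * π) * ∫ t in (0 : ℝ)..T₀, t * ∫ θ in (0 : ℝ)..2 * π, ⟪fderiv ℝ V (axisPt s t θ) eZ, eZ⟫ := by
    rw [← intervalIntegral.integral_const_mul]
    exact intervalIntegral.integral_congr fun t _ => by ring
  rw [hrad, hpull]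
  linear_combination (1 / (2 * π)) * hFTC.symm

end Summit.NavierStokesRegularity.NavierStokesRegularity.Theorems.PowerGaugeEulerLiouville.HoopCore

end
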